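import Mathlib
import HarnessLib
import Summits.HubbardSuperconductivity.HubbardSuperconductivity.Theorems.KLProgrammeKLRegimeSplitEdgeFactsBandJetsSup
import Summits.HubbardSuperconductivity.HubbardSuperconductivity.Theorems.KLProgrammeKLRegimeSplitEdgeFactsTransferModulusComplDeepV
import Summits.HubbardSuperconductivity.HubbardSuperconductivity.Theorems.KLProgrammeKLRegimeSplitEdgeFactsPinnedFloorWindowV
import Summits.HubbardSuperconductivity.HubbardSuperconductivity.Theorems.KLProgrammeKLRegimeSplitEdgeFactsDeepConditionV

/-!
# Route `KLProgramme` — edge facts for the pair masses ACROSS TRANSFERS, XXI: the (D2)-DEEP ROW, the (D3′) PER-STEP FLOOR and the DEEP CONDITION KEYED TO THE REGIME —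
# every jet constant read off the frame's `C²` size `A = 2Gfr₀|U| + 2Gfr₁U² + Gfr₂·c/log 4` of an admissible frame of the KL regime (no `coeffNorm`, no `IsAdmissibleFrame`)

Cell gate-hubbard-kl, seat hubbard-kl-k3c1-p1 (g22; child-1 lineage); the ONE-CALL end of the cure of «(s2)-JETS-COEFFNORM-KEYING».  Composition only:
row 20′ (`…BandJetsSup`: `klbs_nambuXiCT_jets_of_frameOK_regime`, `v = 4 + 2A`, `κ = 4 + 8A`) feeds the abstract twins 25b′ (`…TransferModulusComplDeepV`),
32′ (`…PinnedFloorWindowV`) and 34′ (`…DeepConditionV`).  For a frame `K` with `FrameOK R U (nScales β) μ K` in the regime `klBetaMin ≤ β ≤ e^{c/U²}` (`0 ≤ c`,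
`0 ≤ Gfr j`) — in particular every flow frame `K_n = klFlowFrameU … n` the (s2) masses are taken at — and the smallness `A ≤ 2` (a `U`- and `c`-threshold,
`PerturbedFermiCurve.frame_thresholds`):
* §1 `klrg_size_nonneg`, `klrg_jet_bounds` (`4 ≤ v`, `4 ≤ κ`, `v, κ ≤ 20`, `v ≤ 32` from `0 ≤ A ≤ 2`);
* §2 **`klrg_abs_sum_klTransferWeight_sub_pin_le_numeric`** — THE (D2)-DEEP ROW of the complementary members keyed to the regime:
  `0 < β ≤ L`, `1 ≤ n`, `n + 1 ≤ m`, `π/β ≤ 2Λ_n`, `(4 + 2A)·|p_Q|_𝕋 ≤ Λ_n/16` ⟹ `|Σ_p t_n[s_{n,m}](Q,p) − Σ_p t_n[s_{n,m}](0,p)| ≤ 1.413764·10¹¹·(|p_Q|_𝕋/Λ_n)²`,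
  `m`-uniform, `βL²` cancelled, valid AT EVERY DEPTH of the flow (the admissible-frame numeric row of g21 was vacuous there);
* §3 **`klrg_pinned_mass_floor_of_windows`** — the (D3′) per-step floor with `X = (B−A)L/(2π(4 + 2A)) − 1` points per column (n-flat: `b_lo ≍ (w−u)(B−A)/((4+2A)Λ_n)·…`);
* §4 **`klrg_deep_of_isPairClassAt_seven`** — in a pair class exiting at resolution `j + 7` the scale `j` is deep for `v = 4 + 2A` (`A ≤ 14` suffices; here `A ≤ 2`).
Everything is proved; no definitions; nothing asserts any slot, stub, K3 or SC.
References: BGM 2006 §2.4 (2.36) (frame sizes along the flow) [cite: BenfattoGiulianiMastropietro2006]; the rows themselves [folklore].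
-/

noncomputable section

namespace Summit.HubbardSuperconductivity.HubbardSuperconductivity.Theorems.KLRegimeSplit

set_option linter.dupNamespace false -- summit = problem name (single-conjunct summit), D-0017

open Real Finset Literature.MathematicalPhysics.QuantumLattice Literature.Probability.LatticeModels
open Summit.HubbardSuperconductivity.HubbardSuperconductivity.Theorems.KLProgrammeLegKernels
open Summit.HubbardSuperconductivity.HubbardSuperconductivity.Theorems.DispersionFlow
open Summit.HubbardSuperconductivity.HubbardSuperconductivity.Theorems.PerturbedFermiCurve

section Regime

variable {L M : ℕ} [NeZero L] (β μ : ℝ) {K : TrigPolyC4v}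
variable {R : RenConsts} (hR : ∀ j, 0 ≤ R.Gfr j) {U c βf : ℝ} (hc : 0 ≤ c) (hβmin : klBetaMin ≤ βf) (hβc : βf ≤ Real.exp (c / U ^ 2))
  (hK : FrameOK R U (nScales βf) μ K) (hA2 : 2 * R.Gfr 0 * |U| + 2 * R.Gfr 1 * U ^ 2 + R.Gfr 2 * (c / Real.log 4) ≤ 2)

/-! ## §1 The jet constants of the regime keying: `v = 4 + 2A`, `κ = 4 + 8A`, `0 ≤ A ≤ 2` -/

include hR hc in
/-- `0 ≤ A` for `A = 2Gfr₀|U| + 2Gfr₁U² + Gfr₂·c/log 4`. -/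
theorem klrg_size_nonneg : 0 ≤ 2 * R.Gfr 0 * |U| + 2 * R.Gfr 1 * U ^ 2 + R.Gfr 2 * (c / Real.log 4) := by
  have h0 := hR 0; have h1 := hR 1; have h2 := hR 2
  have hlog : 0 ≤ Real.log 4 := Real.log_nonneg (by norm_num)
  positivity

include hR hc hA2 in
/-- The four inequalities the abstract twins ask of `v = 4 + 2A`, `κ = 4 + 8A` when `0 ≤ A ≤ 2`: `4 ≤ v`, `4 ≤ κ`, `v ≤ 20`, `κ ≤ 20` (and `v ≤ 32`). -/
theorem klrg_jet_bounds :
    4 ≤ 4 + 2 * (2 * R.Gfr 0 * |U| + 2 * R.Gfr 1 * U ^ 2 + R.Gfr 2 * (c / Real.log 4)) ∧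
      4 ≤ 4 + 8 * (2 * R.Gfr 0 * |U| + 2 * R.Gfr 1 * U ^ 2 + R.Gfr 2 * (c / Real.log 4)) ∧
        4 + 2 * (2 * R.Gfr 0 * |U| + 2 * R.Gfr 1 * U ^ 2 + R.Gfr 2 * (c / Real.log 4)) ≤ 20 ∧
          4 + 8 * (2 * R.Gfr 0 * |U| + 2 * R.Gfr 1 * U ^ 2 + R.Gfr 2 * (c / Real.log 4)) ≤ 20 ∧
            4 + 2 * (2 * R.Gfr 0 * |U| + 2 * R.Gfr 1 * U ^ 2 + R.Gfr 2 * (c / Real.log 4)) ≤ 32 := by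
  have h0 := klrg_size_nonneg hR hc (U := U)
  refine ⟨by linarith, by linarith, by linarith, by linarith, by linarith⟩

/-! ## §2 The (D2)-deep row of the complementary members, keyed to the regime -/

include hR hc hβmin hβc hK hA2 in
/-- **THE (D2)-DEEP ROW KEYED TO THE REGIME** (module docstring): for a frame with `FrameOK R U (nScales β_f) μ K` in the KL regime and `A ≤ 2`,
`|Σ_p t_n[s_{n,m}](Q,p) − Σ_p t_n[s_{n,m}](0,p)| ≤ 1.413764·10¹¹·(|p_Q|_𝕋/Λ_n)²` under `0 < β ≤ L`, `1 ≤ n`, `n + 1 ≤ m`, `π/β ≤ 2Λ_n` and the deep condition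
`(4 + 2A)·|p_Q|_𝕋 ≤ Λ_n/16`.  (`β_f`, the regime's inverse temperature the frame was built at, and the propagators' `β` may differ; in the engine they coincide;
the frame's `μ` is the band's `μ`, as the soft count `klsc_card_soft_le_of_frameOK` requires.)
[cite: BenfattoGiulianiMastropietro2006, §2.4 (2.36)] -/
theorem klrg_abs_sum_klTransferWeight_sub_pin_le_numeric [NeZero M] (hβ : 0 < β) (hβL : β ≤ L) {n m : ℕ} (hn : 1 ≤ n) (hnm : n + 1 ≤ m)
    (hΛβ : Real.pi / β ≤ 2 * klScale klE0 n) (Q : TorusSite 2 L)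
    (hdeep : (4 + 2 * (2 * R.Gfr 0 * |U| + 2 * R.Gfr 1 * U ^ 2 + R.Gfr 2 * (c / Real.log 4))) * klTorusNorm L Q ≤ klScale klE0 n / 16) :
    |∑ p, klTransferWeight L M β μ K n (softSymbolCompl L M β μ K n m) Q p - ∑ p, klTransferWeight L M β μ K n (softSymbolCompl L M β μ K n m) 0 p| ≤
      141376400000 * (klTorusNorm L Q / klScale klE0 n) ^ 2 := by
  obtain ⟨hv4, hκ4, hv20, hκ20, -⟩ := klrg_jet_bounds hR hc hA2 (U := U)
  exact klcdv_abs_sum_klTransferWeight_sub_pin_le_numeric β μ K (klbs_nambuXiCT_jets_of_frameOK_regime μ hR hc hβmin hβc hK) hv4 hκ4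
    hK hv20 hκ20 hβ hβL hn hnm hΛβ Q hdeep

/-! ## §3 The (D3′) per-step pinned floor from explicit windows, keyed to the regime -/

include hR hc hβmin hβc hK in
/-- **THE (D3′) PER-STEP FLOOR KEYED TO THE REGIME**: row 32's one call with `X = (B−A)L/(2π(4 + 2A)) − 1` points per crossing column (all other inputs — the
Matsubara window `(k, W)`, the level window `(A′, B′)`, the angular window `(u, w)` — as in `klpw_pinned_mass_floor_of_windows`):
`(64/243)·2k·Y·X/(βL²Λ_n²) ≤ −Σ_p t_n[s_{n,m}](0,p)`. [folklore] -/
theorem klrg_pinned_mass_floor_of_windows [NeZero M] (hβ : 0 < β) {n m : ℕ} (hnm : n + 1 ≤ m) {k : ℕ} (hk : k ≤ M) {W : ℝ}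
    (hkW : (2 * (k : ℝ) - 1) * π / β ≤ W) (hW2 : W ^ 2 ≤ klScale klE0 n ^ 2 / 8) {A' B' : ℝ} (hAB : A' ≤ B') (hB : B' ≤ 0)
    (hB2 : klScale klE0 n ^ 2 / 2 ≤ B' ^ 2) (hA2' : A' ^ 2 ≤ 5 * klScale klE0 n ^ 2 / 8)
    (hX : 0 ≤ (B' - A') * L / (2 * π * (4 + 2 * (2 * R.Gfr 0 * |U| + 2 * R.Gfr 1 * U ^ 2 + R.Gfr 2 * (c / Real.log 4)))) - 1)
    {u w : ℝ} (hu : 0 ≤ u) (huw : u ≤ w) (hw : w ≤ π) (hwin_lo : (-2 - μ + K.coeffNorm 0 - A') / 2 ≤ Real.cos w)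
    (hwin_hi : Real.cos u ≤ (2 * Real.cos (π / L) - μ - K.coeffNorm 0 - B') / 2) :
    64 / 243 * (2 * (k : ℝ) * ((((w - u) * L / (2 * π) - 1)) *
        ((B' - A') * L / (2 * π * (4 + 2 * (2 * R.Gfr 0 * |U| + 2 * R.Gfr 1 * U ^ 2 + R.Gfr 2 * (c / Real.log 4)))) - 1)) /
        (β * (L : ℝ) ^ 2 * klScale klE0 n ^ 2)) ≤
      -∑ p, klTransferWeight L M β μ K n (softSymbolCompl L M β μ K n m) 0 p := by
  have hv4 : (4 : ℝ) ≤ 4 + 2 * (2 * R.Gfr 0 * |U| + 2 * R.Gfr 1 * U ^ 2 + R.Gfr 2 * (c / Real.log 4)) := by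
    have := klrg_size_nonneg hR hc (U := U); linarith
  exact klpwv_pinned_mass_floor_of_windows β μ K (klbs_nambuXiCT_jets_of_frameOK_regime μ hR hc hβmin hβc hK) hv4
    hβ hnm hk hkW hW2 hAB hB hB2 hA2' hX hu huw hw hwin_lo hwin_hi

/-! ## §4 The deep condition in the pair-class vocabulary, keyed to the regime -/

omit [NeZero L] in
include hR hc hA2 in
/-- **DEEP FROM THE PAIR CLASS, KEYED TO THE REGIME**: `IsPairClassAt L Q (j + 7)` ⟹ `(4 + 2A)·|p_Q|_𝕋 ≤ Λ_j/16` (`v = 4 + 2A ≤ 32`, `512·32 = 4⁷`):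
in a class exiting at resolution `N` the scales `j ≤ N − 7` are deep. [folklore] -/
theorem klrg_deep_of_isPairClassAt_seven {Q : TorusSite 2 L} {j : ℕ} (h : IsPairClassAt L Q (j + 7)) :
    (4 + 2 * (2 * R.Gfr 0 * |U| + 2 * R.Gfr 1 * U ^ 2 + R.Gfr 2 * (c / Real.log 4))) * klTorusNorm L Q ≤ klScale klE0 j / 16 := by
  obtain ⟨hv4, -, -, -, hv32⟩ := klrg_jet_bounds hR hc hA2 (U := U)
  exact kldcv_deep_of_isPairClassAt_seven (by linarith) hv32 h

end Regime

end Summit.HubbardSuperconductivity.HubbardSuperconductivity.Theorems.KLRegimeSplit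

end
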